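import Summits.HubbardSuperconductivity.HubbardSuperconductivity.Theorems.AnisotropyChordDressHalfFilledOrderInheritance
import Summits.HubbardSuperconductivity.HubbardSuperconductivity.Theorems.LevyLogBootstrapDressHalfFilledDictionaryExhaustion
import HarnessLib

/-!
# Crux `DressHalfFilled` (stmt-HubbardSuperconductivity-8148, routes `AnisotropyChord` / `LevyLogBootstrap`), stub 3
# `stub_dressHalfFilled`: FROM CONCENTRATION DATA TO PAIR-FIELD ORDER (the fixed-`L` assembly, penultimate step)

Helper file (`--supports stmt-HubbardSuperconductivity-8148`). Combines `…OrderInheritance` with the two concentration inputs into an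
explicit order bound for a dressed state `Φφ + q`:

* `xxz_rayleigh_le_of_xform_le` — translating a bound on the clause-(d) form `Re⟨φ, (2J·H + k·1)φ⟩ ≤ B` (the output of
  `…SecondOrderSelection`) into `Re⟨φ, Hφ⟩ ≤ e‖φ‖² + (B − (2Je + k)‖φ‖²)/(2J)` (`J > 0`);
* `order_ge_of_concentration_data` — for `Φ = dictionaryMap M U` (`M ≥ 2`), a spin vector `φ` of the sector `S^z_tot = 0` and a fermion
  vector `q` with `‖φ‖² = 1 − ν`, `Re⟨φ, Hφ⟩ ≤ e‖φ‖² + δ` (`δ ≥ 0`), the gap/defect inequality of `H` on the sector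
  (`…ConcentrationLemmas.defect_le_of_rayleigh_le`, constant `γ`), the order `c_Λ ≤ Λ` on the unit vectors of the ground multiplet
  `E` of `H` (for `H = H_M(Δ_eff)`: `HalfFilledOrder`), and a form bound `Re⟨r, Δ_d†Δ_d r⟩ ≤ ω‖r‖²`:
  **`½·c(U)²·c_Λ·(1 − ν − δ/γ) − 2ω·(δ/γ + ν) ≤ Re⟨Φφ + q, Δ_d†Δ_d (Φφ + q)⟩`**.
  For a sector ground state `ψ = Pψ + (ψ − Pψ) = Φφ + q` of `H_in + t'T` one has `ν = O(t'²)` (`…SecondOrderTransverse`) and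
  `δ = O(t')` (`…SecondOrderSelection` + `xxz_rayleigh_le_of_xform_le`), so the right-hand side is `½c²c_Λ − O_L(t')`: the anchor at
  fixed `L` with `t₀ = t₀(L)` — every constant (`γ, ω`, the gap and form bound behind `ν, δ`) depends on `L`.

HONEST LABEL: fixed-`L` only; the uniform statement (stub 3 / the crux) is untouched; no crux and no summit statement is proved.
Sources: T. Kato (1966) II-§2.3 [Kato1966]; W.-F. Tsai, S. A. Kivelson, PRB 73 (2006) 214510, App. A [TsaiKivelson2006].
No definition and no named fact is introduced; sorry-free.
-/

noncomputable section

-- `dupNamespace`: the summit and the problem are both named `HubbardSuperconductivity` (layout D-0022)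
set_option linter.dupNamespace false

namespace Summit.HubbardSuperconductivity.HubbardSuperconductivity.Theorems.AnisotropyChord.DressSecond

open Matrix Literature.MathematicalPhysics.QuantumLattice Literature.Probability.LatticeModels
open Literature.MathematicalPhysics.QuantumLattice.TorusPlaquette
open Summit.HubbardSuperconductivity.HubbardSuperconductivity.Theorems.LevyLogBootstrap (star_sub_proj_dotProduct)
open scoped ComplexOrder

section Spin

variable {n : Type*} [Fintype n] [DecidableEq n]

/-- **From the clause-(d) form to the XXZ Rayleigh quotient.** For `J > 0` and any `H`, `φ`, `B`, `e`:
`Re⟨φ, (2J·H + k·1)φ⟩ ≤ B` gives `Re⟨φ, Hφ⟩ ≤ e‖φ‖² + (B − (2Je + k)‖φ‖²)/(2J)` (an identity-rearrangement). [bookkeeping] -/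
theorem xxz_rayleigh_le_of_xform_le (H : Matrix n n ℂ) {J k B e : ℝ} (hJ : 0 < J) (φ : n → ℂ)
    (hB : (star φ ⬝ᵥ ((((2 * J : ℝ) : ℂ) • H + ((k : ℝ) : ℂ) • 1) *ᵥ φ)).re ≤ B) :
    (star φ ⬝ᵥ (H *ᵥ φ)).re ≤ e * (star φ ⬝ᵥ φ).re + (B - (2 * J * e + k) * (star φ ⬝ᵥ φ).re) / (2 * J) := by
  rw [add_mulVec, smul_mulVec, smul_mulVec, one_mulVec, dotProduct_add, dotProduct_smul, dotProduct_smul, smul_eq_mul,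
    smul_eq_mul, Complex.add_re, Complex.re_ofReal_mul, Complex.re_ofReal_mul] at hB
  have h2J : (0:ℝ) < 2 * J := by positivity
  have key : (star φ ⬝ᵥ (H *ᵥ φ)).re * (2 * J) ≤ B - k * (star φ ⬝ᵥ φ).re := by linarith
  have h1 : (star φ ⬝ᵥ (H *ᵥ φ)).re ≤ (B - k * (star φ ⬝ᵥ φ).re) / (2 * J) := by
    rw [le_div_iff₀ h2J]; exact key
  have e1 : (B - k * (star φ ⬝ᵥ φ).re) / (2 * J) =
      e * (star φ ⬝ᵥ φ).re + (B - (2 * J * e + k) * (star φ ⬝ᵥ φ).re) / (2 * J) := by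
    field_simp
    ring
  exact h1.trans_eq e1

end Spin

section Plaquette

variable {M : ℕ} [NeZero M]

set_option linter.style.longLine false in
/-- **Order from concentration data.** `M ≥ 2`, `Φ = dictionaryMap M U`, `H` a matrix on the spin space, `e : ℝ`,
`E = (S^z_tot = 0) ⊓ ker(H − e)` with orthogonal projection `P_E`. Data: a spin vector `φ` of the sector `S^z_tot = 0` with
`‖φ‖² = 1 − ν` and `Re⟨φ, Hφ⟩ ≤ e‖φ‖² + δ`; the defect inequality
`∀ φ' ∈ sector, ∀ δ', Re⟨φ', Hφ'⟩ ≤ e·‖φ'‖² + δ' → ‖φ'‖² − Re⟨φ', P_E φ'⟩ ≤ δ'/γ`; the order bound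
`c_Λ ≤ Re⟨ψ₀, S⁺_tot S⁻_tot ψ₀⟩` for unit `ψ₀ ∈ E`, `c_Λ ≥ 0`; a form bound `Re⟨r, Δ_d†Δ_d r⟩ ≤ ω‖r‖²` (`ω ≥ 0`). Then for every fermion
vector `q` with `‖q‖² ≤ ν`: `½·c(U)²·c_Λ·(1 − ν − δ/γ) − 2ω(δ/γ + ν) ≤ Re⟨Φφ + q, Δ_d†Δ_d (Φφ + q)⟩`. [folklore] -/
theorem order_ge_of_concentration_data (hM : 2 ≤ M) (U : ℝ)
    (H : Matrix (TensorIndex (TorusSite 2 M) 2) (TensorIndex (TorusSite 2 M) 2) ℂ) (e cΛ γ ω δ ν : ℝ)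
    (hcΛ : 0 ≤ cΛ) (hω : 0 ≤ ω)
    (hΛ : ∀ ψ₀ : TensorIndex (TorusSite 2 M) 2 → ℂ,
      ψ₀ ∈ spinZSector (Λ := TorusSite 2 M) 1 0 ⊓ Module.End.eigenspace (Matrix.toLin' H) (e : ℂ) → star ψ₀ ⬝ᵥ ψ₀ = 1 →
        cΛ ≤ (star ψ₀ ⬝ᵥ Matrix.mulVec ((∑ x : TorusSite 2 M, onSite x (spinRaise 1)) *
          (∑ y : TorusSite 2 M, onSite y (spinLower 1))) ψ₀).re)
    (hdef : ∀ φ' : TensorIndex (TorusSite 2 M) 2 → ℂ, φ' ∈ spinZSector (Λ := TorusSite 2 M) 1 0 → ∀ δ' : ℝ,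
      (star φ' ⬝ᵥ (H *ᵥ φ')).re ≤ e * (star φ' ⬝ᵥ φ').re + δ' →
      (star φ' ⬝ᵥ φ').re - (star φ' ⬝ᵥ (projMatrix ((spinZSector (Λ := TorusSite 2 M) 1 0 ⊓
          Module.End.eigenspace (Matrix.toLin' H) (e : ℂ)).map
          ((WithLp.linearEquiv 2 ℂ (TensorIndex (TorusSite 2 M) 2 → ℂ)).symm :
            (TensorIndex (TorusSite 2 M) 2 → ℂ) →ₗ[ℂ] EuclideanSpace ℂ (TensorIndex (TorusSite 2 M) 2))) *ᵥ φ')).re ≤ δ' / γ)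
    (hωr : ∀ r : Fock (Orb (FermionTorus 2 (2 * M))),
      (star r ⬝ᵥ (((pairField dWaveFormFactor (2 * M))ᴴ * pairField dWaveFormFactor (2 * M)) *ᵥ r)).re ≤ ω * (star r ⬝ᵥ r).re)
    {φ : TensorIndex (TorusSite 2 M) 2 → ℂ} (hφ : φ ∈ spinZSector (Λ := TorusSite 2 M) 1 0)
    (hnφ : (star φ ⬝ᵥ φ).re = 1 - ν) (hHφ : (star φ ⬝ᵥ (H *ᵥ φ)).re ≤ e * (star φ ⬝ᵥ φ).re + δ)
    {q : Fock (Orb (FermionTorus 2 (2 * M)))} (hq : (star q ⬝ᵥ q).re ≤ ν) :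
    1 / 2 * (plaquettePairCouplings U).c ^ 2 * cΛ * (1 - ν - δ / γ) - 2 * ω * (δ / γ + ν) ≤
      (star (dictionaryMap M U *ᵥ φ + q) ⬝ᵥ
        (((pairField dWaveFormFactor (2 * M))ᴴ * pairField dWaveFormFactor (2 * M)) *ᵥ (dictionaryMap M U *ᵥ φ + q))).re := by
  set E : Submodule ℂ (TensorIndex (TorusSite 2 M) 2 → ℂ) :=
    spinZSector (Λ := TorusSite 2 M) 1 0 ⊓ Module.End.eigenspace (Matrix.toLin' H) (e : ℂ) with hE
  set P : Matrix (TensorIndex (TorusSite 2 M) 2) (TensorIndex (TorusSite 2 M) 2) ℂ :=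
    projMatrix (E.map ((WithLp.linearEquiv 2 ℂ (TensorIndex (TorusSite 2 M) 2 → ℂ)).symm :
      (TensorIndex (TorusSite 2 M) 2 → ℂ) →ₗ[ℂ] EuclideanSpace ℂ (TensorIndex (TorusSite 2 M) 2))) with hP
  set O := (pairField dWaveFormFactor (2 * M))ᴴ * pairField dWaveFormFactor (2 * M) with hO
  set Φ := dictionaryMap M U with hΦdef
  have hPh : P.IsHermitian := projMatrix_isHermitian _
  have hPP : P * P = P := projMatrix_mul_self _
  have hiso : Φᴴ * Φ = 1 := dictionaryMap_conjTranspose_mul_self U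
  -- the inheritance inequality
  have hinh := order_ge_near_groundMultiplet hM U H e cΛ hΛ φ q
  -- the defect of `φ`
  have hdφ := hdef φ hφ δ hHφ
  set dφ : ℝ := (star φ ⬝ᵥ φ).re - (star φ ⬝ᵥ (P *ᵥ φ)).re with hdφdef
  have hPform : (star φ ⬝ᵥ (P *ᵥ φ)).re = 1 - ν - dφ := by rw [hdφdef, hnφ]; ring
  -- the remainder `r' = Φ(φ − Pφ) + q`: `‖r'‖² ≤ 2(‖φ − Pφ‖² + ‖q‖²) = 2(dφ + ‖q‖²)`
  have hw : (star (Φ *ᵥ (φ - P *ᵥ φ)) ⬝ᵥ (Φ *ᵥ (φ - P *ᵥ φ))).re = dφ := by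
    rw [star_mulVec, ← dotProduct_mulVec, mulVec_mulVec, hiso, one_mulVec, star_sub_proj_dotProduct hPh.eq hPP,
      Complex.sub_re, hdφdef]
  have hpar : ∀ a b : Fock (Orb (FermionTorus 2 (2 * M))),
      (star (a + b) ⬝ᵥ (a + b)).re ≤ 2 * ((star a ⬝ᵥ a).re + (star b ⬝ᵥ b).re) := by
    intro a b
    have h0 : 0 ≤ (star (a - b) ⬝ᵥ (a - b)).re := (Complex.nonneg_iff.mp (dotProduct_star_self_nonneg _)).1
    have e1 : star (a + b) ⬝ᵥ (a + b) = star a ⬝ᵥ a + star a ⬝ᵥ b + star b ⬝ᵥ a + star b ⬝ᵥ b := by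
      rw [star_add, add_dotProduct, dotProduct_add, dotProduct_add]; ring
    have e2 : star (a - b) ⬝ᵥ (a - b) = star a ⬝ᵥ a - star a ⬝ᵥ b - star b ⬝ᵥ a + star b ⬝ᵥ b := by
      rw [star_sub, sub_dotProduct, dotProduct_sub, dotProduct_sub]; ring
    rw [e1]; rw [e2] at h0
    simp only [Complex.add_re, Complex.sub_re] at h0 ⊢
    linarith
  have hr' := hpar (Φ *ᵥ (φ - P *ᵥ φ)) q
  rw [hw] at hr'
  have hωr' := hωr (Φ *ᵥ (φ - P *ᵥ φ) + q)
  have hr'0 : 0 ≤ (star (Φ *ᵥ (φ - P *ᵥ φ) + q) ⬝ᵥ (Φ *ᵥ (φ - P *ᵥ φ) + q)).re :=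
    (Complex.nonneg_iff.mp (dotProduct_star_self_nonneg _)).1
  -- assemble
  rw [hPform] at hinh
  have hc2 : 0 ≤ (plaquettePairCouplings U).c ^ 2 := sq_nonneg _
  have h1 : 1 / 2 * ((plaquettePairCouplings U).c ^ 2 * (cΛ * (1 - ν - δ / γ))) ≤
      1 / 2 * ((plaquettePairCouplings U).c ^ 2 * (cΛ * (1 - ν - dφ))) := by
    have : 1 - ν - δ / γ ≤ 1 - ν - dφ := by linarith
    have := mul_le_mul_of_nonneg_left this hcΛ
    have := mul_le_mul_of_nonneg_left this hc2
    linarith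
  have h2 : ω * (star (Φ *ᵥ (φ - P *ᵥ φ) + q) ⬝ᵥ (Φ *ᵥ (φ - P *ᵥ φ) + q)).re ≤ 2 * ω * (δ / γ + ν) := by
    have : (star (Φ *ᵥ (φ - P *ᵥ φ) + q) ⬝ᵥ (Φ *ᵥ (φ - P *ᵥ φ) + q)).re ≤ 2 * (δ / γ + ν) := by linarith
    have := mul_le_mul_of_nonneg_left this hω
    linarith
  linarith

end Plaquette

end Summit.HubbardSuperconductivity.HubbardSuperconductivity.Theorems.AnisotropyChord.DressSecond

end
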